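import Summits.QuantumFields.YangMills.Theorems.ParabolicTrajectoryTunedSequenceExistsQFemtoAspectwise
import Summits.QuantumFields.YangMills.Theorems.ParabolicTrajectoryTunedSequenceExistsQNonFemto

/-!
# Crux `TunedSequenceExists` (stmt-QuantumFields-10524), `Q`-restatement kit: the one new child in
# SLACK form — `VolumeMonotoneQSlack` (V_Q,slack), weaker than (V_Q,rel), same one-new-child reduction,
# and its FREE corners modulo the sibling crux stmt-QuantumFields-16204 (lead c6, 2026-08-17)

Lead c5 landed `QFemto.tunedSequenceExistsQ_of_femtoC_of_volumeRel : FemtoCurvatureTwoPointC →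
VolumeMonotoneQRelAll → TunedSequenceExistsQ` with the purely relative child (V_Q,rel)
`u_Q(β, m, L₁M^m) ≤ K · u_Q(β, m, L)`.  The composition with the sibling-given height
`(U_Q,∃h) = FemtoLowerBoundQ` only needs the comparison up to a slack below that height, so the child
weakens to

  (V_Q,slack) `VolumeMonotoneQSlack r M`:
  `∃ K > 0, ∃ LV, ∀ L₁ ≥ LV, ∀ ε > 0, ∃ β₁ m₁, ∀ β ≥ β₁, m ≥ m₁, L ≥ L₁ M^m:
     u_Q(β, m, L₁ M^m) ≤ K · u_Q(β, m, L) + ε`,   `u_Q(β, m, L) := (M^m)⁸ ⟨Q ; τ_{M^m} Q⟩_{β, 2L+1}`.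

* `volumeMonotoneQSlack_of_rel`: (V_Q,rel) ⇒ (V_Q,slack) (slack unused) — strictly fewer demands: the
  relative form forces `u_Q(big) ≥ u_Q(small)/K > 0` wherever `u_Q(small) > 0`, in particular in the deep
  infrared where only UPPER bounds (clustering) can ever be available; the slack form asks nothing there.
* `tunedSequenceExistsQ_of_femtoC_of_volumeSlack : FemtoCurvatureTwoPointC → VolumeMonotoneQSlackAll →
  TunedSequenceExistsQ` — the one-new-child reduction with the weaker child (`θ₀ = h/(2K)`).
* FREE CORNERS of (V_Q,slack) (kernel-checked): (i) both tori femto in the sibling's units — the bracket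
  `cΓ ≤ u_Q ≤ CΓ` gives the inequality with `K = C/c` and any `ε ≥ 0` (`volumeSlackQ_femto_pair`); (ii)
  small torus femto of large aspect — `u_Q(small) ≤ ε` (`femtoQ_le_of_cruxCAtWith`) and
  `u_Q(big) ≥ 0` (reflection positivity) give it for every `K ≥ 0` and EVERY big torus
  (`volumeSlackQ_femto_small`); (iii) bounded depth — fixed-torus freezing on the finitely many small
  tori + RP on the big ones (`volumeSlackQ_of_depth_le`).  What is left is the comparison, at physical
  separations `M^m · a(β)` bounded AWAY from `0`, of the aspect-`L₁` torus with arbitrarily large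
  NON-femto tori: the weak-coupling thermodynamic limit proper (necessary by
  `QFemto.tunedSequenceExists_witnesses_not_femto`).
-/

noncomputable section

open Filter Topology MeasureTheory
open Literature.MathematicalPhysics.QuantumFieldTheory Literature.MathematicalPhysics.QuantumLattice

namespace Summit.QuantumFields.YangMills.Theorems.TunedSequenceExists.QFemto

open RPDiagonalVariant (spatialPlaquette)

variable {G : Type} [Group G] [TopologicalSpace G] [IsTopologicalGroup G] [CompactSpace G]
  [MeasurableSpace G] [BorelSpace G]

/-! ## The slack child -/

/-- **(V_Q,slack) — constant-factor-plus-slack volume comparison for the time-zero plaquette `Q`.**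
There are `K > 0` and an aspect floor `LV` such that for every aspect `L₁ ≥ LV` and every slack `ε > 0`
there are `β₁, m₁` with `u_Q(β, m, L₁ M^m) ≤ K · u_Q(β, m, L) + ε` for all `β ≥ β₁`, `m ≥ m₁`,
`L ≥ L₁ M^m`.  Obligation piece (candidate child of the `Q`-restated crux); not a published fact. -/
def VolumeMonotoneQSlack (r : LatticeRep G) (M : ℕ) : Prop :=
  ∃ K : ℝ, 0 < K ∧ ∃ LV : ℕ, ∀ L₁ : ℕ, LV ≤ L₁ → ∀ ε : ℝ, 0 < ε → ∃ (β₁ : ℝ) (m₁ : ℕ),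
    ∀ (β : ℝ) (m L : ℕ), β₁ ≤ β → m₁ ≤ m → L₁ * M ^ m ≤ L →
      ((M : ℝ) ^ m) ^ 8 *
          latticeConnectedCorr r.ρ β (2 * (L₁ * M ^ m) + 1) (spatialPlaquette r) (spatialPlaquette r) (M ^ m) ≤
        K * (((M : ℝ) ^ m) ^ 8 *
          latticeConnectedCorr r.ρ β (2 * L + 1) (spatialPlaquette r) (spatialPlaquette r) (M ^ m)) + ε

/-- (V_Q,slack) under the crux prefix (every compact simple `G`, Borel structure `borel G`, every `r`,
every `M ≥ 2`). -/
def VolumeMonotoneQSlackAll : Prop :=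
  ∀ (G : Type) [Group G] [TopologicalSpace G] [IsTopologicalGroup G] [CompactSpace G],
    IsCompactSimpleLieGroup G → letI : MeasurableSpace G := borel G
    haveI : BorelSpace G := ⟨rfl⟩
    ∀ (r : LatticeRep G) (M : ℕ), 2 ≤ M → VolumeMonotoneQSlack r M

/-- **(V_Q,rel) ⇒ (V_Q,slack)** (the slack is unused). [folklore] -/
theorem volumeMonotoneQSlack_of_rel (r : LatticeRep G) {M : ℕ} (h : VolumeMonotoneQRel r M) :
    VolumeMonotoneQSlack r M := by
  obtain ⟨K, hK, LV, hV⟩ := h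
  refine ⟨K, hK, LV, fun L₁ hL₁ ε hε => ?_⟩
  obtain ⟨β₁, m₁, hV'⟩ := hV L₁ hL₁
  exact ⟨β₁, m₁, fun β m L hβ hm hL => by linarith [hV' β m L hβ hm hL]⟩

/-- (V_Q,rel) ⇒ (V_Q,slack) under the crux prefix. [folklore] -/
theorem volumeMonotoneQSlackAll_of_relAll (h : VolumeMonotoneQRelAll) : VolumeMonotoneQSlackAll := by
  intro G _ _ _ _ hG
  letI : MeasurableSpace G := borel G
  haveI : BorelSpace G := ⟨rfl⟩
  intro r M hM
  exact volumeMonotoneQSlack_of_rel r (h G hG r M hM)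

/-- The zero table inhabits the SHAPE of (V_Q,slack): no lower-bound content (the core's shape fails for
the zero table, `FixedAspectSplit.not_lowerBoundShape_zero`). -/
theorem volumeMonotoneQSlackShape_zero (M : ℕ) :
    ∃ K : ℝ, 0 < K ∧ ∃ LV : ℕ, ∀ L₁ : ℕ, LV ≤ L₁ → ∀ ε : ℝ, 0 < ε → ∃ (β₁ : ℝ) (m₁ : ℕ),
      ∀ (β : ℝ) (m L : ℕ), β₁ ≤ β → m₁ ≤ m → L₁ * M ^ m ≤ L →
        ((M : ℝ) ^ m) ^ 8 * (fun (_ : ℝ) (_ _ : ℕ) => (0 : ℝ)) β (L₁ * M ^ m) (M ^ m) ≤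
          K * (((M : ℝ) ^ m) ^ 8 * (fun (_ : ℝ) (_ _ : ℕ) => (0 : ℝ)) β L (M ^ m)) + ε :=
  ⟨1, one_pos, 0, fun _ _ ε hε => ⟨0, 0, fun _ _ _ _ _ _ => by simpa using hε.le⟩⟩

/-! ## The one-new-child reduction with the slack child -/

/-- **(U_Q,∃h) + (V_Q,slack) ⇒ the window lower bound for `Q`** (fix the aspect `L₁ = max LU LV` before
the floors; height `h(L₁)`, slack `ε = h/2`, window height `θ₀ = h/(2K)`). -/
theorem coreQ_of_femtoLower_of_volumeSlack (r : LatticeRep G) {M : ℕ} (hU : FemtoLowerBoundQ r M)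
    (hV : VolumeMonotoneQSlack r M) :
    ∃ θ₀ : ℝ, 0 < θ₀ ∧ ∀ (B : ℝ) (m₀ L₀ : ℕ), ∃ m : ℕ, m₀ ≤ m ∧ ∃ L : ℕ, L₀ * M ^ m ≤ L ∧
      ∃ β : ℝ, B ≤ β ∧ θ₀ ≤ ((M : ℝ) ^ m) ^ 8 *
        latticeConnectedCorr r.ρ β (2 * L + 1) (spatialPlaquette r) (spatialPlaquette r) (M ^ m) := by
  obtain ⟨LU, hU⟩ := hU
  obtain ⟨K, hK, LV, hV⟩ := hV
  set L₁ : ℕ := max LU LV with hL₁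
  obtain ⟨h, hh, hU'⟩ := hU L₁ (le_max_left _ _)
  obtain ⟨β₁, m₁, hV'⟩ := hV L₁ (le_max_right _ _) (h / 2) (half_pos hh)
  refine ⟨h / (2 * K), by positivity, fun B m₀ L₀ => ?_⟩
  obtain ⟨m, hm, β, hβ, hu⟩ := hU' (max B β₁) (max m₀ m₁)
  refine ⟨m, (le_max_left _ _).trans hm, max L₀ L₁ * M ^ m, Nat.mul_le_mul_right _ (le_max_left _ _), β,
    (le_max_left _ _).trans hβ, ?_⟩
  have hstep := hV' β m (max L₀ L₁ * M ^ m) ((le_max_right _ _).trans hβ) ((le_max_right _ _).trans hm)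
    (Nat.mul_le_mul_right _ (le_max_right _ _))
  rw [div_le_iff₀ (by positivity : (0 : ℝ) < 2 * K)]
  nlinarith

/-- **The one-new-child reduction with the WEAKER child.**
`FemtoCurvatureTwoPointC → VolumeMonotoneQSlackAll → TunedSequenceExistsQ`: granted the sibling
tier-deciding crux (stmt-QuantumFields-16204), the `Q`-restated crux follows from (V_Q,slack) alone —
(U_Q,∃h) is the sibling's (`femtoLowerBoundQ_of_femtoCurvatureTwoPointC`), exact tuning is the IVT glue
and clause (iii) is reflection positivity (`RPDiagonalVariant.weakQ_of_lowerBound` / `windowQ_of_weak`). -/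
theorem tunedSequenceExistsQ_of_femtoC_of_volumeSlack
    (hF : Summit.QuantumFields.YangMills.Theses.LangevinControlUV.FemtoCurvatureTwoPointC)
    (hV : VolumeMonotoneQSlackAll) : RPDiagonalVariant.TunedSequenceExistsQ := by
  intro G _ _ _ _ hG
  letI : MeasurableSpace G := borel G
  haveI : BorelSpace G := ⟨rfl⟩
  intro r M hM
  have hU := femtoLowerBoundQ_of_femtoCurvatureTwoPointC hF G hG r M hM
  obtain ⟨θ₀, hθ₀, hweak⟩ := RPDiagonalVariant.weakQ_of_lowerBound r hM
    (coreQ_of_femtoLower_of_volumeSlack r hU (hV G hG r M hM))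
  refine ⟨θ₀, hθ₀, fun θ hθ hθ' => ?_⟩
  obtain ⟨sch, n, hshape, hβ, hlim⟩ := hweak θ hθ hθ'
  exact RPDiagonalVariant.windowQ_of_weak r M θ sch n hshape hβ hlim

/-- Consistency: the c5 reduction factors through the slack one. -/
example (hF : Summit.QuantumFields.YangMills.Theses.LangevinControlUV.FemtoCurvatureTwoPointC)
    (hV : VolumeMonotoneQRelAll) : RPDiagonalVariant.TunedSequenceExistsQ :=
  tunedSequenceExistsQ_of_femtoC_of_volumeSlack hF (volumeMonotoneQSlackAll_of_relAll hV)

/-! ## Free corners of (V_Q,slack) modulo the sibling crux -/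

/-- The slack inequality from smallness of the small-torus value and non-negativity of the big-torus
value (the latter is reflection positivity for `Q`). [folklore] -/
theorem slack_of_le_of_nonneg {K ε us ub : ℝ} (hK : 0 ≤ K) (hs : us ≤ ε) (hb : 0 ≤ ub) :
    us ≤ K * ub + ε := by
  nlinarith [mul_nonneg hK hb]

/-- **(i) Both tori femto: the inequality holds with `K = C/c` and any slack `ε ≥ 0`.**  Under
`CruxCAtWith r a Γ β₀ ℓ₀ c C`, for `β ≥ β₀`, aspect `L₁ ≥ 4`, depth `D = M^m` (`M ≥ 1`) and any
`L ≥ L₁ M^m` whose torus `2L+1` is femto (`(2L+1) · a β ≤ ℓ₀`; then the smaller torus is femto too),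
`u_Q(β, m, L₁ M^m) ≤ (C/c) · u_Q(β, m, L) + ε` — the sibling bracket at the common argument `M^m · a β`
(`QFemto.rescaledQ_femto_volume_ratio`). -/
theorem volumeSlackQ_femto_pair (r : LatticeRep G) {a Γ : ℝ → ℝ} {β₀ ℓ₀ c C : ℝ}
    (h : CruxCAtWith r a Γ β₀ ℓ₀ c C) {β : ℝ} (hβ : β₀ ≤ β) {M m L₁ L : ℕ} (hM : 1 ≤ M)
    (hL₁ : 4 ≤ L₁) (hL : L₁ * M ^ m ≤ L) (hfem : ((2 * L + 1 : ℕ) : ℝ) * a β ≤ ℓ₀) {ε : ℝ}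
    (hε : 0 ≤ ε) :
    ((M : ℝ) ^ m) ^ 8 *
        latticeConnectedCorr r.ρ β (2 * (L₁ * M ^ m) + 1) (spatialPlaquette r) (spatialPlaquette r) (M ^ m) ≤
      C / c * (((M : ℝ) ^ m) ^ 8 *
        latticeConnectedCorr r.ρ β (2 * L + 1) (spatialPlaquette r) (spatialPlaquette r) (M ^ m)) + ε := by
  have hc := h.2.1
  have hapos := h.2.2.1 β
  set n : ℕ := M ^ m with hn_def
  have hn1 : 1 ≤ n := Nat.one_le_pow _ _ (by omega)
  have hn_cast : ((M : ℝ) ^ m) = (n : ℝ) := by rw [hn_def]; norm_cast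
  -- the small torus is femto as well
  have hsmall_le' : 2 * (L₁ * n) + 1 ≤ 2 * L + 1 := Nat.add_le_add_right (Nat.mul_le_mul_left 2 hL) 1
  have hsmall_le : ((2 * (L₁ * n) + 1 : ℕ) : ℝ) ≤ ((2 * L + 1 : ℕ) : ℝ) := by exact_mod_cast hsmall_le'
  have hfem' : ((2 * (L₁ * n) + 1 : ℕ) : ℝ) * a β ≤ ℓ₀ :=
    (mul_le_mul_of_nonneg_right hsmall_le hapos.le).trans hfem
  have h8 : 8 * n ≤ 2 * (L₁ * n) + 1 := by nlinarith [hL₁, Nat.zero_le n]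
  have h8' : 8 * n ≤ 2 * L + 1 := by
    have : 8 * n ≤ 2 * (L₁ * n) := by nlinarith [hL₁, Nat.zero_le n]
    omega
  have hratio := rescaledQ_femto_volume_ratio r h hβ (2 * (L₁ * n) + 1) (2 * L + 1) hfem' hfem hn1 h8 h8'
  rw [hn_cast]
  -- divide the bracket comparison `c · u(small) ≤ C · u(big)` by `c > 0`
  have h1 : (n : ℝ) ^ 8 * latticeConnectedCorr r.ρ β (2 * (L₁ * n) + 1) (spatialPlaquette r) (spatialPlaquette r) n ≤
      C / c * ((n : ℝ) ^ 8 * latticeConnectedCorr r.ρ β (2 * L + 1) (spatialPlaquette r) (spatialPlaquette r) n) := by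
    rw [div_mul_eq_mul_div, le_div_iff₀ hc]
    linarith
  linarith

/-- **(ii) Small torus femto, large aspect: the inequality holds for EVERY `K ≥ 0` and EVERY big
torus.**  Under `CruxCAtWith r a Γ β₀ ℓ₀ c C` with `a` continuous, for every `ε > 0` there is an aspect
floor `A` such that for `L₁ ≥ A`, `β ≥ max β₀ 0`, `D = M^m ≥ 1` with the torus `2 L₁ M^m + 1` femto, and
ANY half-side `L`: `u_Q(β, m, L₁M^m) ≤ K · u_Q(β, m, L) + ε` — the small side is `≤ ε`
(`femtoQ_le_of_cruxCAtWith`: physical separation `< ℓ₀/(2L₁)`, where `Γ` is small) and the big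
side is `≥ 0` (reflection positivity). -/
theorem volumeSlackQ_femto_small (r : LatticeRep G) {a Γ : ℝ → ℝ} {β₀ ℓ₀ c C : ℝ}
    (h : CruxCAtWith r a Γ β₀ ℓ₀ c C) (ha : Continuous a) {K : ℝ} (hK : 0 ≤ K) {ε : ℝ} (hε : 0 < ε) :
    ∃ A : ℕ, ∀ L₁ : ℕ, A ≤ L₁ → ∀ (β : ℝ) (M m L : ℕ), β₀ ≤ β → 0 ≤ β → 1 ≤ M →
      ((2 * (L₁ * M ^ m) + 1 : ℕ) : ℝ) * a β ≤ ℓ₀ →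
        ((M : ℝ) ^ m) ^ 8 *
            latticeConnectedCorr r.ρ β (2 * (L₁ * M ^ m) + 1) (spatialPlaquette r) (spatialPlaquette r) (M ^ m) ≤
          K * (((M : ℝ) ^ m) ^ 8 *
            latticeConnectedCorr r.ρ β (2 * L + 1) (spatialPlaquette r) (spatialPlaquette r) (M ^ m)) + ε := by
  obtain ⟨A, hA⟩ := femtoQ_le_of_cruxCAtWith r h ha hε
  refine ⟨A, fun L₁ hL₁ β M m L hβ hβ0 hM hfem => ?_⟩
  have hD1 : 1 ≤ M ^ m := Nat.one_le_pow _ _ (by omega)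
  have hn_cast : ((M : ℝ) ^ m) = ((M ^ m : ℕ) : ℝ) := by norm_cast
  have hsmall := hA L₁ hL₁ β (M ^ m) hβ hD1 hfem
  rw [hn_cast]
  exact slack_of_le_of_nonneg hK hsmall
    (by exact_mod_cast RPDiagonalVariant.rescaled_nonneg r hβ0 M m L (M ^ m))

/-- **(iii) Bounded depth: the inequality holds for EVERY `K ≥ 0` beyond a coupling floor**, for all
`m ≤ m̄` and ALL `L` — fixed-torus freezing on the finitely many small tori
(`RPDiagonalVariant.latticeConnectedCorr_spatialPlaquette_tendsto_zero`) and reflection positivity on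
the big ones.  (No sibling input.) [folklore] -/
theorem volumeSlackQ_of_depth_le (r : LatticeRep G) (M L₁ : ℕ) {K : ℝ} (hK : 0 ≤ K) {ε : ℝ}
    (hε : 0 < ε) (mbar : ℕ) :
    ∃ β₁ : ℝ, ∀ (β : ℝ) (m L : ℕ), β₁ ≤ β → m ≤ mbar →
      ((M : ℝ) ^ m) ^ 8 *
          latticeConnectedCorr r.ρ β (2 * (L₁ * M ^ m) + 1) (spatialPlaquette r) (spatialPlaquette r) (M ^ m) ≤
        K * (((M : ℝ) ^ m) ^ 8 *
          latticeConnectedCorr r.ρ β (2 * L + 1) (spatialPlaquette r) (spatialPlaquette r) (M ^ m)) + ε := by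
  have hsmall : ∀ᶠ β : ℝ in atTop, ∀ m ∈ Finset.range (mbar + 1), ((M : ℝ) ^ m) ^ 8 *
      latticeConnectedCorr r.ρ β (2 * (L₁ * M ^ m) + 1) (spatialPlaquette r) (spatialPlaquette r)
        (M ^ m) < ε := by
    refine ((Finset.range (mbar + 1)).eventually_all).2 fun m _ => ?_
    have h := (RPDiagonalVariant.latticeConnectedCorr_spatialPlaquette_tendsto_zero r
      (2 * (L₁ * M ^ m) + 1) (M ^ m)).const_mul (((M : ℝ) ^ m) ^ 8)
    rw [mul_zero] at h
    exact h.eventually_lt_const hε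
  obtain ⟨B, hB⟩ := eventually_atTop.1 hsmall
  refine ⟨max B 0, fun β m L hβ hm => ?_⟩
  have h1 := hB β ((le_max_left _ _).trans hβ) m (Finset.mem_range.2 (Nat.lt_succ_of_le hm))
  exact slack_of_le_of_nonneg hK h1.le
    (RPDiagonalVariant.rescaled_nonneg r ((le_max_right _ _).trans hβ) M m L (M ^ m))

/-- **The depth floor of (V_Q,slack) is idle** (as for the `P`-forms): `VolumeMonotoneQSlack r M` is
equivalent to its `∀ m` variant. [folklore] -/
theorem volumeMonotoneQSlack_iff_allDepths (r : LatticeRep G) (M : ℕ) :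
    VolumeMonotoneQSlack r M ↔
      ∃ K : ℝ, 0 < K ∧ ∃ LV : ℕ, ∀ L₁ : ℕ, LV ≤ L₁ → ∀ ε : ℝ, 0 < ε → ∃ β₁ : ℝ,
        ∀ (β : ℝ) (m L : ℕ), β₁ ≤ β → L₁ * M ^ m ≤ L →
          ((M : ℝ) ^ m) ^ 8 *
              latticeConnectedCorr r.ρ β (2 * (L₁ * M ^ m) + 1) (spatialPlaquette r) (spatialPlaquette r) (M ^ m) ≤
            K * (((M : ℝ) ^ m) ^ 8 *
              latticeConnectedCorr r.ρ β (2 * L + 1) (spatialPlaquette r) (spatialPlaquette r) (M ^ m)) + ε := by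
  constructor
  · rintro ⟨K, hK, LV, hLV⟩
    refine ⟨K, hK, LV, fun L₁ h1 ε hε => ?_⟩
    obtain ⟨β₁, m₁, hV⟩ := hLV L₁ h1 ε hε
    obtain ⟨β₁', hD⟩ := volumeSlackQ_of_depth_le r M L₁ hK.le hε m₁
    refine ⟨max β₁ β₁', fun β m L hβ hL => ?_⟩
    rcases le_or_gt m₁ m with hm | hm
    · exact hV β m L ((le_max_left _ _).trans hβ) hm hL
    · exact hD β m L ((le_max_right _ _).trans hβ) hm.le
  · rintro ⟨K, hK, LV, hLV⟩
    refine ⟨K, hK, LV, fun L₁ h1 ε hε => ?_⟩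
    obtain ⟨β₁, hV⟩ := hLV L₁ h1 ε hε
    exact ⟨β₁, 0, fun β m L hβ _ hL => hV β m L hβ hL⟩

end Summit.QuantumFields.YangMills.Theorems.TunedSequenceExists.QFemto

end
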